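import Summits.CriticalPhenomena.PercolationContinuityZ3.Theorems.Transplant.SkelPhiCellsWeakG
import Summits.CriticalPhenomena.PercolationContinuityZ3.Theorems.Transplant.KNCells2RootChain
import HarnessLib

/-!
# N1 (the `{±1}` node), (R) column (N1-R-PLAN v2 §4 (R4)): THE VERTEX-LEVEL ROOMS OF THE ROOT RUN at hp-8's scheme of record
# `cellGeomSG₂ G ψ P t Λ` (cell map `ψ` with `Lip` + `WeakSteps`, e.g. the fine cell map) — FOOTPRINT conditions that put a vertex of the root's
# ball into the root world `Q_{0}(0) ∪ E_{0}(0, du)` resp. into the target box `M_0(0 + du)`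

The (R) chain runs in the ball window graph of the root; its step regions are windows of the RUN FRAMES, so the rooms `D_k ⊆ U'` and `T'_N ⊆ M`
of the generic assembly `Skel.rootOblTWAt_of_chain₂` (SkelRootChainW) are discharged in two stages: (i) run box ↦ footprint box of the cell map (the
reading lemmas of `SkelPhiParaRunFine(Box)` / `SkelPhiNegReachRoomsRun`), (ii) footprint box ↦ vertex span — THIS FILE: a vertex `v ∈ B_G(t, R)` whose
footprint `ψ v` has signed level `λ = sgOf du · (ψ v)_{du.1} ∈ [−5r∥ + 1, 25r∥ − 1]` and transverse coordinate `|(ψ v)_⊥| ≤ 5r⊥ − 2` lies in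
`Q_0(0) ∪ Btw_0(0,du) ∪ Q_0(0+du)` once `R + 1 ≤` the three radii (`Skelφ.mem_U0root_of_footprint`); with `|λ − 20r∥| ≤ 3r∥ − 1`, `|(ψ v)_⊥| ≤ 3r⊥ − 1` and
`R + 1 ≤ rM` it lies in `M_0(0+du)` (`mem_rootM_of_footprint`).  The span neighbour is supplied by `WeakSteps` (`exists_adj_upBox/downBox`), not by unit steps.
builds on p205010 (kernel theorem, internal audit signed; external expert review pending) — nothing in this file uses p205010; nothing here is a claim about the open node.
Lane `prim-bschramm`, seat `prim-bschramm-p3` (gen 9; design owner + (R) owner); helper file (`--supports stmt-CriticalPhenomena-4575 --as helper`).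
[cite: KozmaNitzan2024, §4 pp. 25–26 (Q_v, M_v, E_{v,x}), p. 28 ((32) at the root)]
-/

noncomputable section

open scoped Classical

namespace Summit.CriticalPhenomena.PercolationContinuityZ3.Theorems

namespace Transplant

namespace Skelφ

open Literature.Probability.Percolation Literature.Probability.LatticeModels SimpleGraph KNCells
open Literature.Probability.Percolation.KozmaNitzan
open Literature.Probability.Percolation.KozmaNitzan.Cells (oth oth_ne sgOf sgOf_sign stepVec_apply_fst stepVec_apply_oth eq_oth_of_ne oth_oth)
open Literature.Barriers.CriticalPhenomena (graphBall mem_graphBall_self graphBall_mono)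
open BoxProdZ2 (ConcRadiiG)
open PlanarSkeletonConc (mem_vspan_edgesIn_of_adj)

variable {V : Type} [DecidableEq V] {G : SimpleGraph V} [G.LocallyFinite] {ψ : V → Site 2}

/-! ## §1 Span membership from two adjacent footprints -/

/-- **The span device**: a vertex `y` of depth `≤ n`, `n + 1 ≤ R`, and a `G`-neighbour `m`, both with footprints in `Pl`, put `y` into `VWin Pl R`. [this work] -/
theorem mem_VWin_of_adj_footprints {t : V} {Pl : Finset (Site 2)} {R n : ℕ} {y m : V} (hy : y ∈ graphBall G t n) (hn : n + 1 ≤ R)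
    (hadj : G.Adj y m) (hPy : ψ y ∈ Pl) (hPm : ψ m ∈ Pl) : y ∈ VWin G ψ t Pl R := by
  refine (mem_vspan_edgesIn_of_adj ?_ ?_ hadj).1
  · exact (mem_Win G ψ).2 ⟨graphBall_mono G t (by omega) hy, hPy⟩
  · exact (mem_Win G ψ).2 ⟨graphBall_mono G t hn (BoxProdZ2.mem_graphBall_succ_of_adj G hy hadj), hPm⟩

/-! ## §2 The planar boxes of the root world at the root cell `v = 0`, in level form -/

section Planar

variable (P : PCells2) (du : MDir)

/-- `P.Q 0` in level form: `|sgOf du · z_a| ≤ 5r∥` and `|z_⊥| ≤ 5r⊥`. [folklore] -/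
theorem mem_Q_zero_of_levels {z : Site 2} (ha : |sgOf du * z du.1| ≤ 5 * (P.r du.1 : ℤ)) (hb : |z (oth du.1)| ≤ 5 * (P.r (oth du.1) : ℤ)) :
    z ∈ P.Q 0 := by
  rw [PCells2.Q, PCells2.mem_abox_iff]
  intro i
  simp only [PCells2.cen_zero, Pi.zero_apply, zero_sub, zero_add, Nat.cast_mul, Nat.cast_ofNat]
  have hσ := sgOf_sign du
  by_cases hi : i = du.1
  · subst hi
    rcases hσ with h | h <;> rw [h] at ha <;> [rw [one_mul] at ha; rw [neg_one_mul, abs_neg] at ha] <;> exact ⟨by linarith [(abs_le.1 ha).1], (abs_le.1 ha).2⟩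
  · rw [eq_oth_of_ne hi]
    exact ⟨by linarith [(abs_le.1 hb).1], (abs_le.1 hb).2⟩

/-- `P.BtwN 0 du` in level form: `5r∥ + 1 ≤ sgOf du · z_a ≤ 15r∥ − 1` and `|z_⊥| ≤ 5r⊥ − 1`. [folklore] -/
theorem mem_BtwN_zero_of_levels {z : Site 2} (ha₁ : 5 * (P.r du.1 : ℤ) + 1 ≤ sgOf du * z du.1) (ha₂ : sgOf du * z du.1 ≤ 15 * (P.r du.1 : ℤ) - 1)
    (hb : |z (oth du.1)| ≤ 5 * (P.r (oth du.1) : ℤ) - 1) : z ∈ P.BtwN 0 du := by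
  rw [PCells2.BtwN, mem_sBox_iff (sgOf_sign du)]
  simp only [PCells2.cen_zero, Pi.zero_apply, sub_zero, zero_sub, zero_add]
  refine ⟨⟨by linarith, by linarith⟩, fun j hj => ?_⟩
  rw [eq_oth_of_ne hj]
  have h1 := (abs_le.1 hb).1
  have h2 := (abs_le.1 hb).2
  constructor <;> omega

/-- `P.Q (0 + stepVec du)` in level form: `15r∥ ≤ sgOf du · z_a ≤ 25r∥` and `|z_⊥| ≤ 5r⊥`. [folklore] -/
theorem mem_Q_stepVec_of_levels {z : Site 2} (ha₁ : 15 * (P.r du.1 : ℤ) ≤ sgOf du * z du.1) (ha₂ : sgOf du * z du.1 ≤ 25 * (P.r du.1 : ℤ))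
    (hb : |z (oth du.1)| ≤ 5 * (P.r (oth du.1) : ℤ)) : z ∈ P.Q ((0 : Site 2) + stepVec du) := by
  rw [PCells2.Q, PCells2.mem_abox_iff]
  intro i
  simp only [zero_add, PCells2.cen_apply, Nat.cast_mul, Nat.cast_ofNat]
  have hσ := sgOf_sign du
  by_cases hi : i = du.1
  · subst hi
    rw [stepVec_apply_fst]
    rcases hσ with h | h <;> rw [h] at ha₁ ha₂ ⊢ <;> constructor <;> linarith
  · rw [eq_oth_of_ne hi, stepVec_apply_oth]
    exact ⟨by linarith [(abs_le.1 hb).1], by linarith [(abs_le.1 hb).2]⟩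

/-- `P.M (0 + stepVec du)` in level form: `|sgOf du · z_a − 20r∥| ≤ 3r∥` and `|z_⊥| ≤ 3r⊥`. [folklore] -/
theorem mem_M_stepVec_of_levels {z : Site 2} (ha : |sgOf du * z du.1 - 20 * (P.r du.1 : ℤ)| ≤ 3 * (P.r du.1 : ℤ))
    (hb : |z (oth du.1)| ≤ 3 * (P.r (oth du.1) : ℤ)) : z ∈ P.M ((0 : Site 2) + stepVec du) := by
  rw [PCells2.M, PCells2.mem_abox_iff]
  intro i
  simp only [zero_add, PCells2.cen_apply, Nat.cast_mul, Nat.cast_ofNat]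
  have hσ := sgOf_sign du
  by_cases hi : i = du.1
  · subst hi
    rw [stepVec_apply_fst]
    have h1 := (abs_le.1 ha).1
    have h2 := (abs_le.1 ha).2
    rcases hσ with h | h <;> rw [h] at h1 h2 ⊢ <;> constructor <;> linarith
  · rw [eq_oth_of_ne hi, stepVec_apply_oth]
    exact ⟨by linarith [(abs_le.1 hb).1], by linarith [(abs_le.1 hb).2]⟩

end Planar

/-! ## §3 The rooms at the scheme of record -/

section Rooms

variable (P : PCells2) (t : V) (Λ : ConcRadiiG) (q : unitInterval) (δc : ℝ) (du : MDir)

omit [DecidableEq V] [G.LocallyFinite] in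
/-- The level of a footprint along `du` from the root cell and its transverse coordinate move by at most one along an edge (`Lip`). [folklore] -/
theorem levels_of_adj (hlip : Lip G ψ) {y m : V} (hadj : G.Adj y m) :
    |sgOf du * ψ m du.1 - sgOf du * ψ y du.1| ≤ 1 ∧ |ψ m (oth du.1) - ψ y (oth du.1)| ≤ 1 := by
  refine ⟨?_, by rw [abs_sub_comm]; exact hlip hadj (oth du.1)⟩
  have h := hlip hadj du.1
  rw [abs_sub_comm] at h
  rcases sgOf_sign du with hs | hs <;> rw [hs]
  · simpa using h
  · rw [show (-1 : ℤ) * ψ m du.1 - -1 * ψ y du.1 = -(ψ m du.1 - ψ y du.1) by ring, abs_neg]; exact h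

/-- **ROOM 1: the root cube.**  A vertex of depth `≤ R` whose footprint has level `∈ [−5r∥ + 1, 5r∥]` and transverse coordinate `≤ 5r⊥ − 1` in absolute value
lies in `Q_0(0)` (`R + 1 ≤ rQ 0 0`; span neighbour one level DOWN-or-equal). [cite: KozmaNitzan2024, §4 p. 26 (Q_v)] -/
theorem mem_rootQ_of_footprint (hlip : Lip G ψ) (hws : WeakSteps G ψ) {R : ℕ} (hR : R + 1 ≤ Λ.rQ 0 0) {v : V} (hv : v ∈ graphBall G t R)
    (h₁ : -(5 * (P.r du.1 : ℤ)) + 1 ≤ sgOf du * ψ v du.1) (h₂ : sgOf du * ψ v du.1 ≤ 5 * (P.r du.1 : ℤ))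
    (hb : |ψ v (oth du.1)| ≤ 5 * (P.r (oth du.1) : ℤ) - 1) :
    v ∈ (cellGeomSG₂ G ψ P t Λ).Q 0 0 := by
  obtain ⟨m, hadj, hml, hml', hmt⟩ := exists_adj_downBox hlip hws P du 0 v
  simp only [PCells2.lev, PCells2.cen_zero, Pi.zero_apply, sub_zero] at hml hml'
  change v ∈ VWin G ψ t (P.Q 0) (Λ.rQ 0 0)
  refine mem_VWin_of_adj_footprints hv hR hadj ?_ ?_
  · exact mem_Q_zero_of_levels P du (abs_le.2 ⟨by linarith, h₂⟩) (by have := (abs_le.1 hb); exact abs_le.2 ⟨by linarith [this.1], by linarith [this.2]⟩)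
  · refine mem_Q_zero_of_levels P du (abs_le.2 ⟨by linarith, by linarith⟩) ?_
    have h1 := (abs_le.1 hb); have h2 := (abs_le.1 hmt)
    exact abs_le.2 ⟨by linarith [h1.1, h2.1], by linarith [h1.2, h2.2]⟩

/-- **ROOM 2: the between-box.**  Level `∈ [5r∥ + 1, 15r∥ − 1]`, transverse `≤ 5r⊥ − 2`, `R + 1 ≤ rB 0 0 du` ⟹ `v ∈ Btw_0(0, du)` (span neighbour one level up-or-equal, or
down-or-equal at the far end). [cite: KozmaNitzan2024, §4 p. 26 (E_{v,x})] -/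
theorem mem_rootBtw_of_footprint (hlip : Lip G ψ) (hws : WeakSteps G ψ) {R : ℕ} (hR : R + 1 ≤ Λ.rB 0 0 du) {v : V} (hv : v ∈ graphBall G t R)
    (h₁ : 5 * (P.r du.1 : ℤ) + 1 ≤ sgOf du * ψ v du.1) (h₂ : sgOf du * ψ v du.1 ≤ 15 * (P.r du.1 : ℤ) - 1)
    (hb : |ψ v (oth du.1)| ≤ 5 * (P.r (oth du.1) : ℤ) - 2) :
    v ∈ (cellGeomSG₂ G ψ P t Λ).Btw 0 0 du := by
  change v ∈ VWin G ψ t (P.BtwN 0 du) (Λ.rB 0 0 du)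
  have hr : (1 : ℤ) ≤ P.r du.1 := by exact_mod_cast P.one_le_r du.1
  have hbv : |ψ v (oth du.1)| ≤ 5 * (P.r (oth du.1) : ℤ) - 1 := hb.trans (by linarith)
  by_cases hfar : sgOf du * ψ v du.1 ≤ 15 * (P.r du.1 : ℤ) - 2
  · obtain ⟨m, hadj, hml, hml', hmt⟩ := exists_adj_upBox hlip hws P du 0 v
    simp only [PCells2.lev, PCells2.cen_zero, Pi.zero_apply, sub_zero] at hml hml'
    refine mem_VWin_of_adj_footprints hv hR hadj (mem_BtwN_zero_of_levels P du h₁ h₂ hbv) (mem_BtwN_zero_of_levels P du (by linarith) (by linarith) ?_)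
    have h1 := (abs_le.1 hb); have h2 := (abs_le.1 hmt)
    exact abs_le.2 ⟨by linarith [h1.1, h2.1], by linarith [h1.2, h2.2]⟩
  · obtain ⟨m, hadj, hml, hml', hmt⟩ := exists_adj_downBox hlip hws P du 0 v
    simp only [PCells2.lev, PCells2.cen_zero, Pi.zero_apply, sub_zero] at hml hml'
    refine mem_VWin_of_adj_footprints hv hR hadj (mem_BtwN_zero_of_levels P du h₁ h₂ hbv) (mem_BtwN_zero_of_levels P du (by linarith) (by linarith) ?_)
    have h1 := (abs_le.1 hb); have h2 := (abs_le.1 hmt)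
    exact abs_le.2 ⟨by linarith [h1.1, h2.1], by linarith [h1.2, h2.2]⟩

/-- **ROOM 3: the child's cube.**  Level `∈ [15r∥, 25r∥ − 1]`, transverse `≤ 5r⊥ − 1`, `R + 1 ≤ rQ 0 (0 + du)` ⟹ `v ∈ Q_0(0 + du)`.
[cite: KozmaNitzan2024, §4 p. 26 (Q_v)] -/
theorem mem_childQ_of_footprint (hlip : Lip G ψ) (hws : WeakSteps G ψ) {R : ℕ} (hR : R + 1 ≤ Λ.rQ 0 ((0 : Site 2) + stepVec du)) {v : V}
    (hv : v ∈ graphBall G t R) (h₁ : 15 * (P.r du.1 : ℤ) ≤ sgOf du * ψ v du.1) (h₂ : sgOf du * ψ v du.1 ≤ 25 * (P.r du.1 : ℤ) - 1)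
    (hb : |ψ v (oth du.1)| ≤ 5 * (P.r (oth du.1) : ℤ) - 1) :
    v ∈ (cellGeomSG₂ G ψ P t Λ).Q 0 ((0 : Site 2) + stepVec du) := by
  change v ∈ VWin G ψ t (P.Q ((0 : Site 2) + stepVec du)) (Λ.rQ 0 ((0 : Site 2) + stepVec du))
  obtain ⟨m, hadj, hml, hml', hmt⟩ := exists_adj_upBox hlip hws P du 0 v
  simp only [PCells2.lev, PCells2.cen_zero, Pi.zero_apply, sub_zero] at hml hml'
  refine mem_VWin_of_adj_footprints hv hR hadj (mem_Q_stepVec_of_levels P du h₁ (by linarith) (hb.trans (by linarith)))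
    (mem_Q_stepVec_of_levels P du (by linarith) (by linarith) ?_)
  have h1 := (abs_le.1 hb); have h2 := (abs_le.1 hmt)
  exact abs_le.2 ⟨by linarith [h1.1, h2.1], by linarith [h1.2, h2.2]⟩

/-- **THE ROOT WORLD FROM A FOOTPRINT**: a vertex of depth `≤ R` whose footprint has level `∈ [−5r∥ + 1, 25r∥ − 1]` and transverse coordinate `≤ 5r⊥ − 2` lies in the
root world `U0root du = Q_0(0) ∪ (Btw_0(0,du) ∪ Q_0(0+du))` of the scheme `⟨cellGeomSG₂ G ψ P t Λ, q, δc⟩`, provided `R + 1 ≤ rQ 0 0, rB 0 0 du, rQ 0 (0+du)`.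
[cite: KozmaNitzan2024, §4 p. 28 ((32) at the root: the world Q₀ ∪ E_{0,v})] -/
theorem mem_U0root_of_footprint (hlip : Lip G ψ) (hws : WeakSteps G ψ) {R : ℕ} (hRQ : R + 1 ≤ Λ.rQ 0 0) (hRB : R + 1 ≤ Λ.rB 0 0 du)
    (hRQ' : R + 1 ≤ Λ.rQ 0 ((0 : Site 2) + stepVec du)) {v : V} (hv : v ∈ graphBall G t R)
    (h₁ : -(5 * (P.r du.1 : ℤ)) + 1 ≤ sgOf du * ψ v du.1) (h₂ : sgOf du * ψ v du.1 ≤ 25 * (P.r du.1 : ℤ) - 1)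
    (hb : |ψ v (oth du.1)| ≤ 5 * (P.r (oth du.1) : ℤ) - 2) :
    v ∈ (⟨cellGeomSG₂ G ψ P t Λ, q, δc⟩ : KSchA V ℕ).U0root du := by
  rw [KSchA.U0root, CellGeom.Ewv]
  change v ∈ (cellGeomSG₂ G ψ P t Λ).Q 0 0 ∪ ((cellGeomSG₂ G ψ P t Λ).Btw 0 0 du ∪ (cellGeomSG₂ G ψ P t Λ).Q 0 ((0 : Site 2) + stepVec du))
  by_cases hQ : sgOf du * ψ v du.1 ≤ 5 * (P.r du.1 : ℤ)
  · exact Finset.mem_union_left _ (mem_rootQ_of_footprint P t Λ du hlip hws hRQ hv h₁ hQ (hb.trans (by linarith)))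
  · by_cases hB : sgOf du * ψ v du.1 ≤ 15 * (P.r du.1 : ℤ) - 1
    · exact Finset.mem_union_right _ (Finset.mem_union_left _ (mem_rootBtw_of_footprint P t Λ du hlip hws hRB hv (by linarith) hB hb))
    · exact Finset.mem_union_right _ (Finset.mem_union_right _
        (mem_childQ_of_footprint P t Λ du hlip hws hRQ' hv (by linarith) h₂ (hb.trans (by linarith))))

/-- **THE TARGET BOX FROM A FOOTPRINT**: level within `3r∥ − 1` of `20r∥`, transverse `≤ 3r⊥ − 1`, depth `≤ R`, `R + 1 ≤ rM 0 (0+du)` ⟹ `v ∈ M_0(0 + du)`.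
[cite: KozmaNitzan2024, §4 p. 26 (M_v)] -/
theorem mem_rootM_of_footprint (hlip : Lip G ψ) (hws : WeakSteps G ψ) {R : ℕ} (hR : R + 1 ≤ Λ.rM 0 ((0 : Site 2) + stepVec du)) {v : V}
    (hv : v ∈ graphBall G t R) (ha : |sgOf du * ψ v du.1 - 20 * (P.r du.1 : ℤ)| ≤ 3 * (P.r du.1 : ℤ) - 1)
    (hb : |ψ v (oth du.1)| ≤ 3 * (P.r (oth du.1) : ℤ) - 1) :
    v ∈ (cellGeomSG₂ G ψ P t Λ).M 0 ((0 : Site 2) + stepVec du) := by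
  change v ∈ VWin G ψ t (P.M ((0 : Site 2) + stepVec du)) (Λ.rM 0 ((0 : Site 2) + stepVec du))
  obtain ⟨m, hadj, -, -, -⟩ := exists_adj_upBox hlip hws P du 0 v
  obtain ⟨hl, ht⟩ := levels_of_adj du hlip hadj
  refine mem_VWin_of_adj_footprints hv hR hadj (mem_M_stepVec_of_levels P du (ha.trans (by linarith)) (hb.trans (by linarith)))
    (mem_M_stepVec_of_levels P du ?_ ?_)
  · have h1 := abs_le.1 ha; have h2 := abs_le.1 hl
    exact abs_le.2 ⟨by linarith [h1.1, h2.1], by linarith [h1.2, h2.2]⟩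
  · have h1 := abs_le.1 hb; have h2 := abs_le.1 ht
    exact abs_le.2 ⟨by linarith [h1.1, h2.1], by linarith [h1.2, h2.2]⟩

end Rooms

end Skelφ

end Transplant

end Summit.CriticalPhenomena.PercolationContinuityZ3.Theorems

end
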